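import Summits.BirchSwinnertonDyer.BirchSwinnertonDyer.Theorems.ManinLocalTwoThreeNewformPinningFiftySix
import Literature.NumberTheory.EllipticCurves.KatoTwistedFinitenessEulerFactorsProofs
import Literature.NumberTheory.EllipticCurves.LFunctionCoefficientBound
import HarnessLib

/-!
# THE PINNING KERNEL, part A: the curve side of an `X₀(N)`-datum as decidable data, and the staged box sieve

Cell `bsd-f2-manin`, route `ManinLocalTwoThree`, cruxes C2 `ManinOddAtFour` (stmt-BirchSwinnertonDyer-22967) and
C3 `ManinPrimeToThreeAtNine` (stmt-22968); planner seat -an gen 54 (`--supports` helper, turnkey T-an-g54-PK).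
Level-generic; nothing here proves C2, C3, Manin's conjecture or BSD.  Part B (`…PinningKernel.lean`) adds the linear
algebra and the pinning; the first instance is `…PinningSixtyThree.lean`.

* THE CURVE SIDE of ANY `X₀(N)`-datum `D` of an elliptic `W/ℚ`, from tree theorems only (no facts):
  `a_{p^e}(W) = ppv N p a_p e` (the recursion (8.44) with `𝟙_N(p) = [p ∤ N]`, read off `dvd_conductorNorm_iff`),
  multiplicativity, `a_p = 0` for `p² ∣ N`, the Hasse box `a_p² ≤ 4p` and `|a_p| < p` for `p ∣ N` (`lFunction_mem_box`);
  a fuel-recursive, kernel-reducible EVALUATOR `evalOpt N σ n` computing `aₙ` from an assignment `σ = [(p, a_p), …]`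
  (sound: `lFunction_eq_of_evalOpt`).
* THE STAGED BOX SIEVE `runSieve N K stages`: stage `(p, rels)` extends every live assignment by every `a_p` in the box
  and keeps those passing the integer relations `rels` (`Σ vₙ aₙ = 0`, checked only where every needed `aₙ` is determined).
  SOUNDNESS (`truth_mem_runSieve`): if every listed `v` is a relation among the `aₙ(W)` (part B derives this from a
  decidable check on certified tables), the TRUE assignment `truth W ps = [(p, a_p(W)), …]` is among the survivors —
  so `decide` on `runSieve` lists every possible curve side at the level.
[cite: CremonaAlgorithms1997, §2.8–2.10] [cite: DiamondShurman2005, §5.8, (8.44)] [cite: AtkinLehner1970, Thm. 3]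
[cite: SilvermanAEC2009, Thm. V.1.1]
-/

set_option autoImplicit false
-- lint-debt: the directory name repeats the summit name (sibling precedent `ManinLocalTwoThreeNewformPinningFiftySix.lean`)
set_option linter.dupNamespace false

noncomputable section

open Complex
open UpperHalfPlane hiding I
open scoped MatrixGroups ModularForm
open ModularForm CongruenceSubgroup
open Literature.NumberTheory.ModularForms
open Literature.NumberTheory.EllipticCurves Literature.NumberTheory.EllipticCurves.ModularForms

namespace Summit.BirchSwinnertonDyer.BirchSwinnertonDyer.Theorems.ManinLocalTwoThree.PinningKernel

/-! ## §A1 The curve side of an `X₀(N)`-datum as decidable data; the sieve -/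

section CurveSide

/-- `a_{p^e}` from `a_p` by (8.44): `ppv 0 = 1`, `ppv 1 = a_p`, `ppv (e+2) = a_p·ppv (e+1) − 𝟙_N(p)·p·ppv e`,
`𝟙_N(p) = [p ∤ N]`. [cite: DiamondShurman2005, (8.44)] -/
def ppv (N p : ℕ) (ap : ℤ) : ℕ → ℤ
  | 0 => 1
  | 1 => ap
  | e + 2 => ap * ppv N p ap (e + 1) - (if p ∣ N then 0 else (p : ℤ)) * ppv N p ap e

/-- Divide out `p` (fuel-recursive): `divideOut p n fuel = (e, m)` with `p^e · m = n`. [folklore] -/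
def divideOut (p : ℕ) : ℕ → ℕ → ℕ × ℕ
  | n, 0 => (0, n)
  | n, fuel + 1 =>
    if 1 < p ∧ 0 < n ∧ p ∣ n then
      match divideOut p (n / p) fuel with
      | (e, m) => (e + 1, m)
    else (0, n)

/-- Partial evaluation of `aₙ` along an assignment `σ = [(p₁, a_{p₁}), …]`: returns `(v, m)` with
`aₙ = v · a_m` whenever `m ≠ 0` (`m` = the cofactor of `n` prime to the assigned primes; `(0,0)` flags an
incomplete division). [folklore] -/
def evalAux (N : ℕ) : List (ℕ × ℤ) → ℕ → ℤ × ℕ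
  | [], n => (1, n)
  | (p, ap) :: σ, n =>
    match divideOut p n n with
    | (e, m) =>
      if p ∣ m then (0, 0) else
        match evalAux N σ m with
        | (v, m') => (ppv N p ap e * v, m')

/-- `aₙ` from the assignment when determined by it (`a₀ = 0`), else `none`. [folklore] -/
def evalOpt (N : ℕ) (σ : List (ℕ × ℤ)) (n : ℕ) : Option ℤ :=
  if n = 0 then some 0 else
    match evalAux N σ n with
    | (v, m) => if m = 1 then some v else none

/-- `⌊√n⌋` by downward structural search on a fuel argument (kernel-reducible, unlike the well-founded
`Nat.sqrt`, so that `decide` can evaluate the boxes). [folklore] -/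
def sqrtFuel (n : ℕ) : ℕ → ℕ
  | 0 => 0
  | k + 1 => if (k + 1) * (k + 1) ≤ n then k + 1 else sqrtFuel n k

/-- Every `m` with `m² ≤ n` and `m ≤ fuel` is below `sqrtFuel n fuel`. [folklore] -/
theorem le_sqrtFuel {n m : ℕ} (hm : m * m ≤ n) : ∀ fuel : ℕ, m ≤ fuel → m ≤ sqrtFuel n fuel
  | 0, h => h
  | k + 1, h => by
    unfold sqrtFuel
    split_ifs with hk
    · exact h
    · refine le_sqrtFuel hm k ?_
      rcases Nat.lt_or_eq_of_le h with h' | h'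
      · omega
      · exact absurd (h' ▸ hm) hk

/-- `⌊√(4p)⌋`. [folklore] -/
def hasseBound (p : ℕ) : ℕ := sqrtFuel (4 * p) (4 * p)

/-- The box of possible `a_p`: `{0}` if `p² ∣ N`, else `|x| ≤ ⌊2√p⌋`, and `|x| < p` if `p ∣ N`. [folklore] -/
def box (N p : ℕ) : List ℤ :=
  if p * p ∣ N then [0] else
    ((List.range (2 * hasseBound p + 1)).map fun i : ℕ ↦ ((i : ℤ) - (hasseBound p : ℤ))).filter
      fun x : ℤ ↦ decide (¬ p ∣ N ∨ x.natAbs < p)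

/-- The value table `[a₀, …, a_{K−1}]` of an assignment (`none` = undetermined). [folklore] -/
def tabulate (N K : ℕ) (σ : List (ℕ × ℤ)) : List (Option ℤ) := (List.range K).map (evalOpt N σ)

/-- Check one integer relation `Σ vₙ aₙ = 0` against a value table; vacuously `true` unless every `aₙ` with
`vₙ ≠ 0` is determined. [folklore] -/
def relCheckTab (tab : List (Option ℤ)) (v : List ℤ) : Bool :=
  (!((List.range v.length).all fun n ↦ decide (v.getD n 0 = 0) || (tab.getD n none).isSome)) ||
    decide (∑ n ∈ Finset.range v.length, v.getD n 0 * (tab.getD n none).getD 0 = 0)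

/-- One sieve stage `(p, rels)`: extend every live assignment by every `a_p` in the box, keep those passing `rels`.
[cite: CremonaAlgorithms1997, §2.8] -/
def sieveStep (N K : ℕ) (live : List (List (ℕ × ℤ))) (st : ℕ × List (List ℤ)) : List (List (ℕ × ℤ)) :=
  (live.flatMap fun σ ↦ (box N st.1).map fun x ↦ σ ++ [(st.1, x)]).filter
    fun σ ↦ st.2.all (relCheckTab (tabulate N K σ))

/-- **The staged box sieve.** [cite: CremonaAlgorithms1997, §2.8] -/
def runSieve (N K : ℕ) (stages : List (ℕ × List (List ℤ))) : List (List (ℕ × ℤ)) :=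
  stages.foldl (sieveStep N K) [[]]

variable (W : WeierstrassCurve ℚ)

/-- The true assignment of `W` on a list of primes (a TRUTHFUL assignment `σ` is one with
`∀ q ∈ σ, q.1.Prime ∧ q.2 = W.LFunction q.1`). [folklore] -/
def truth (ps : List ℕ) : List (ℕ × ℤ) := ps.map fun p ↦ (p, W.LFunction p)

variable {W}

/-- The empty assignment is truthful. [folklore] -/
theorem truthful_nil : ∀ q ∈ ([] : List (ℕ × ℤ)), q.1.Prime ∧ q.2 = W.LFunction q.1 :=
  fun _ h ↦ absurd h List.not_mem_nil

/-- Appending a true prime value keeps an assignment truthful. [folklore] -/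
theorem truthful_append {σ : List (ℕ × ℤ)} (hσ : ∀ q ∈ σ, q.1.Prime ∧ q.2 = W.LFunction q.1) {p : ℕ}
    (hp : p.Prime) : ∀ q ∈ σ ++ [(p, W.LFunction p)], q.1.Prime ∧ q.2 = W.LFunction q.1 := fun q hq ↦ by
  rcases List.mem_append.mp hq with h | h
  · exact hσ q h
  · rw [List.mem_singleton.mp h]; exact ⟨hp, rfl⟩

/-- `truth W ps` is truthful when every entry of `ps` is prime. [folklore] -/
theorem truthful_truth {ps : List ℕ} (hps : ∀ p ∈ ps, p.Prime) :
    ∀ q ∈ truth W ps, q.1.Prime ∧ q.2 = W.LFunction q.1 := fun q hq ↦ by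
  obtain ⟨p, hp, rfl⟩ := List.mem_map.mp hq
  exact ⟨hps p hp, rfl⟩

/-- `truth` unfolds one prime at a time. [folklore] -/
theorem truth_cons (p : ℕ) (ps : List ℕ) : truth W (p :: ps) = [(p, W.LFunction p)] ++ truth W ps := rfl

/-- `divideOut p n fuel = (e, m)` satisfies `p ^ e * m = n`. [folklore] -/
theorem divideOut_spec (p : ℕ) : ∀ fuel n : ℕ, p ^ (divideOut p n fuel).1 * (divideOut p n fuel).2 = n
  | 0, n => by simp [divideOut]
  | fuel + 1, n => by
    unfold divideOut
    split_ifs with h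
    · have ih := divideOut_spec p fuel (n / p)
      rcases hd : divideOut p (n / p) fuel with ⟨e, m⟩
      rw [hd] at ih
      dsimp only at ih ⊢
      rw [pow_succ, mul_assoc, mul_comm p m, ← mul_assoc, ih, Nat.div_mul_cancel h.2.2]
    · simp

variable [W.IsElliptic] {N : ℕ} [NeZero N] (D : ModularParametrizationData W N)

include D in
/-- **`a_{p^e}(W) = ppv N p a_p e`** for any `X₀(N)`-datum ((8.44) + the datum's `p ∣ N_W ↔ p ∣ N`).
[cite: DiamondShurman2005, (8.44)] -/
theorem lFunction_prime_pow_eq_ppv {p : ℕ} (hp : p.Prime) (e : ℕ) :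
    W.LFunction (p ^ e) = ppv N p (W.LFunction p) e := by
  have hind : (if p ∣ W.conductorNorm ℤ then (0 : ℤ) else (p : ℤ)) = if p ∣ N then 0 else (p : ℤ) := by
    by_cases h : p ∣ N
    · rw [if_pos h, if_pos ((NewformPinningFiftySix.dvd_conductorNorm_iff D hp).mpr h)]
    · rw [if_neg h, if_neg (mt (NewformPinningFiftySix.dvd_conductorNorm_iff D hp).mp h)]
  have key : ∀ e, W.LFunction (p ^ e) = ppv N p (W.LFunction p) e ∧
      W.LFunction (p ^ (e + 1)) = ppv N p (W.LFunction p) (e + 1) := by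
    intro e
    induction e with
    | zero => exact ⟨by rw [pow_zero, ppv]; exact W.isMultiplicative_LFunction.map_one, by rw [pow_one, ppv]⟩
    | succ e ih =>
      refine ⟨ih.2, ?_⟩
      rw [W.LFunction_apply_prime_pow_add_two_of_prime hp e, hind, ppv, ih.1, ih.2]
  exact (key e).1

include D in
/-- **Soundness of the partial evaluator**: `aₙ = v · a_m` for `(v, m) = evalAux N σ n`, `m ≠ 0`. [folklore] -/
theorem lFunction_eq_evalAux : ∀ (σ : List (ℕ × ℤ)), (∀ q ∈ σ, q.1.Prime ∧ q.2 = W.LFunction q.1) →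
    ∀ n : ℕ, (evalAux N σ n).2 ≠ 0 →
    W.LFunction n = (evalAux N σ n).1 * W.LFunction (evalAux N σ n).2
  | [], _, n, _ => by simp [evalAux]
  | (p, ap) :: σ, hσ, n, hm => by
    have hp : p.Prime := (hσ (p, ap) (List.mem_cons_self)).1
    have hap : ap = W.LFunction p := (hσ (p, ap) (List.mem_cons_self)).2
    have hσ' : ∀ q ∈ σ, q.1.Prime ∧ q.2 = W.LFunction q.1 := fun q hq ↦ hσ q (List.mem_cons_of_mem _ hq)
    have hspec := divideOut_spec p n n
    revert hm
    unfold evalAux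
    rcases hd : divideOut p n n with ⟨e, m⟩
    rw [hd] at hspec
    dsimp only at hspec ⊢
    split_ifs with hpm
    · intro h; exact absurd rfl h
    · have ih := lFunction_eq_evalAux σ hσ' m
      rcases hv : evalAux N σ m with ⟨v, m'⟩
      rw [hv] at ih
      dsimp only at ih ⊢
      intro hm'
      have hcop : Nat.Coprime (p ^ e) m := Nat.Coprime.pow_left e ((Nat.Prime.coprime_iff_not_dvd hp).mpr hpm)
      rw [← hspec, W.isMultiplicative_LFunction.map_mul_of_coprime hcop, lFunction_prime_pow_eq_ppv D hp e,
        ← hap, ih hm', mul_assoc]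

include D in
/-- **Soundness of the evaluator**: a determined value is the true `aₙ(W)`. [folklore] -/
theorem lFunction_eq_of_evalOpt {σ : List (ℕ × ℤ)} (hσ : ∀ q ∈ σ, q.1.Prime ∧ q.2 = W.LFunction q.1) {n : ℕ} {x : ℤ}
    (h : evalOpt N σ n = some x) : W.LFunction n = x := by
  unfold evalOpt at h
  split_ifs at h with hn
  · rw [hn, ArithmeticFunction.map_zero]; exact Option.some_injective _ h
  · have key := lFunction_eq_evalAux D σ hσ n
    rcases hv : evalAux N σ n with ⟨v, m⟩
    rw [hv] at key h
    dsimp only at key h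
    split_ifs at h with hm
    · rw [key (by rw [hm]; exact one_ne_zero), hm, W.isMultiplicative_LFunction.map_one, mul_one]
      exact Option.some_injective _ h

include D in
/-- **The true `a_p(W)` lies in the box** (`a_p = 0` for `p² ∣ N`; Hasse `a_p² ≤ 4p`; `|a_p| < p` for `p ∣ N`).
[cite: SilvermanAEC2009, Thm. V.1.1] [cite: AtkinLehner1970, Thm. 3] -/
theorem lFunction_mem_box {p : ℕ} (hp : p.Prime) : W.LFunction p ∈ box N p := by
  unfold box
  split_ifs with hsq
  · rw [NewformPinningFiftySix.lFunction_eq_zero_of_sq_dvd D hp (by rwa [pow_two])]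
    exact List.mem_singleton_self _
  · have h1 : ((W.LFunction p : ℤ) : ℝ) ^ 2 ≤ 4 * p := sq_LFunction_prime_le W hp
    have h2 : (W.LFunction p) ^ 2 ≤ 4 * p := by exact_mod_cast h1
    have h3 : (W.LFunction p).natAbs ≤ hasseBound p := by
      have hsq : (W.LFunction p).natAbs * (W.LFunction p).natAbs ≤ 4 * p := by
        have : (((W.LFunction p).natAbs * (W.LFunction p).natAbs : ℕ) : ℤ) ≤ 4 * p := by
          push_cast; rw [abs_mul_abs_self, ← sq]; exact h2
        exact_mod_cast this
      exact le_sqrtFuel hsq (4 * p) ((Nat.le_mul_self _).trans hsq)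
    refine List.mem_filter.mpr ⟨?_, ?_⟩
    · refine List.mem_map.mpr ⟨(W.LFunction p + hasseBound p).toNat, ?_, ?_⟩
      · rw [List.mem_range]; omega
      · omega
    · by_cases hpN : p ∣ N
      · have hlt := abs_LFunction_prime_lt_of_dvd_level D.isNewformOf hp hpN
        have : (((W.LFunction p).natAbs : ℤ) : ℝ) < p := by rw [Int.natCast_natAbs]; exact_mod_cast hlt
        have hlt' : (W.LFunction p).natAbs < p := by exact_mod_cast this
        exact decide_eq_true (Or.inr hlt')
      · exact decide_eq_true (Or.inl hpN)

/-- Reading an entry of `tabulate`. [folklore] -/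
theorem getD_tabulate (N K : ℕ) (σ : List (ℕ × ℤ)) {n : ℕ} (hn : n < K) :
    (tabulate N K σ).getD n none = evalOpt N σ n := by
  rw [tabulate, List.getD_eq_getElem?_getD, List.getElem?_map, List.getElem?_range hn]
  rfl

include D in
/-- **Soundness of the relation check**: a true relation passes on a truthful assignment. [folklore] -/
theorem relCheckTab_true {σ : List (ℕ × ℤ)} (hσ : ∀ q ∈ σ, q.1.Prime ∧ q.2 = W.LFunction q.1) {K : ℕ}
    {v : List ℤ} (hvK : v.length ≤ K) (hrel : ∑ n ∈ Finset.range v.length, v.getD n 0 * W.LFunction n = 0) :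
    relCheckTab (tabulate N K σ) v = true := by
  unfold relCheckTab
  rw [Bool.or_eq_true]
  cases hall : ((List.range v.length).all fun n ↦ decide (v.getD n 0 = 0) || ((tabulate N K σ).getD n none).isSome)
  · left; rfl
  · right
    refine decide_eq_true ?_
    calc ∑ n ∈ Finset.range v.length, v.getD n 0 * ((tabulate N K σ).getD n none).getD 0
        = ∑ n ∈ Finset.range v.length, v.getD n 0 * W.LFunction n := Finset.sum_congr rfl fun n hn ↦ ?_
      _ = 0 := hrel
    have hnK : n < K := lt_of_lt_of_le (Finset.mem_range.mp hn) hvK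
    have hn' := (List.all_eq_true.mp hall) n (List.mem_range.mpr (Finset.mem_range.mp hn))
    rw [Bool.or_eq_true, decide_eq_true_eq] at hn'
    rcases hn' with h0 | hsome
    · rw [h0, zero_mul, zero_mul]
    · obtain ⟨x, hx⟩ := Option.isSome_iff_exists.mp hsome
      rw [hx, Option.getD_some]
      rw [getD_tabulate N K σ hnK] at hx
      rw [lFunction_eq_of_evalOpt D hσ hx]

include D in
/-- One stage keeps the true assignment. [folklore] -/
theorem truth_mem_sieveStep {K : ℕ} {live : List (List (ℕ × ℤ))} {σ₀ : List (ℕ × ℤ)} (h₀ : σ₀ ∈ live)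
    (hσ₀ : ∀ q ∈ σ₀, q.1.Prime ∧ q.2 = W.LFunction q.1) {p : ℕ} (hp : p.Prime) {rels : List (List ℤ)}
    (hrels : ∀ v ∈ rels, v.length ≤ K ∧ ∑ n ∈ Finset.range v.length, v.getD n 0 * W.LFunction n = 0) :
    σ₀ ++ [(p, W.LFunction p)] ∈ sieveStep N K live (p, rels) := by
  unfold sieveStep
  refine List.mem_filter.mpr ⟨?_, ?_⟩
  · exact List.mem_flatMap.mpr ⟨σ₀, h₀, List.mem_map.mpr ⟨W.LFunction p, lFunction_mem_box D hp, rfl⟩⟩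
  · exact List.all_eq_true.mpr fun v hv ↦
      relCheckTab_true D (truthful_append hσ₀ hp) (hrels v hv).1 (hrels v hv).2

include D in
/-- The truthful assignment survives every stage of the sieve fold. [folklore] -/
theorem truth_mem_foldl {K : ℕ} : ∀ (stages : List (ℕ × List (List ℤ))) (live : List (List (ℕ × ℤ)))
    (σ₀ : List (ℕ × ℤ)), σ₀ ∈ live → (∀ q ∈ σ₀, q.1.Prime ∧ q.2 = W.LFunction q.1) → (∀ st ∈ stages, st.1.Prime) →
    (∀ st ∈ stages, ∀ v ∈ st.2, v.length ≤ K ∧ ∑ n ∈ Finset.range v.length, v.getD n 0 * W.LFunction n = 0) →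
    σ₀ ++ truth W (stages.map Prod.fst) ∈ stages.foldl (sieveStep N K) live
  | [], live, σ₀, h, _, _, _ => by simpa [truth] using h
  | st :: stages, live, σ₀, h, hσ, hps, hrels => by
    rw [List.foldl_cons, List.map_cons, truth_cons, ← List.append_assoc]
    exact truth_mem_foldl stages _ _
      (truth_mem_sieveStep D h hσ (hps st List.mem_cons_self) (hrels st List.mem_cons_self))
      (truthful_append hσ (hps st List.mem_cons_self)) (fun s hs ↦ hps s (List.mem_cons_of_mem _ hs))
      (fun s hs ↦ hrels s (List.mem_cons_of_mem _ hs))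

include D in
/-- **SOUNDNESS OF THE SIEVE**: the true assignment `p ↦ a_p(W)` survives every stage. [cite: CremonaAlgorithms1997, §2.8] -/
theorem truth_mem_runSieve {K : ℕ} (stages : List (ℕ × List (List ℤ))) (hps : ∀ st ∈ stages, st.1.Prime)
    (hrels : ∀ st ∈ stages, ∀ v ∈ st.2, v.length ≤ K ∧ ∑ n ∈ Finset.range v.length, v.getD n 0 * W.LFunction n = 0) :
    truth W (stages.map Prod.fst) ∈ runSieve N K stages := by
  have h := truth_mem_foldl D stages [[]] [] (List.mem_singleton_self _) truthful_nil hps hrels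
  rwa [List.nil_append] at h

include D in
/-- **The candidate list**: if `runSieve N K stages = cands` (ONE `decide` at a level), some candidate is truthful —
every `aₙ` it determines is the true `aₙ(W)`. [cite: CremonaAlgorithms1997, §2.8] -/
theorem exists_truthful_of_runSieve_eq {K : ℕ} {stages : List (ℕ × List (List ℤ))}
    (hps : ∀ st ∈ stages, st.1.Prime) (hrels : ∀ st ∈ stages, ∀ v ∈ st.2, v.length ≤ K ∧ ∑ n ∈ Finset.range v.length, v.getD n 0 * W.LFunction n = 0)
    {cands : List (List (ℕ × ℤ))} (hrun : runSieve N K stages = cands) :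
    ∃ σ ∈ cands, ∀ q ∈ σ, q.1.Prime ∧ q.2 = W.LFunction q.1 := by
  refine ⟨truth W (stages.map Prod.fst), hrun ▸ truth_mem_runSieve D stages hps hrels, truthful_truth ?_⟩
  intro p hp
  obtain ⟨st, hst, rfl⟩ := List.mem_map.mp hp
  exact hps st hst

end CurveSide

end Summit.BirchSwinnertonDyer.BirchSwinnertonDyer.Theorems.ManinLocalTwoThree.PinningKernel

end
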